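import Mathlib
import HarnessLib
import Summits.Ventures.LatticeQCDFlow.Scoring.ReversibleKernelTauIntFloor
import Summits.Ventures.LatticeQCDFlow.Exactness.ReversibleComparison

/-!
# Every Markov kernel with an invariant probability law is an exact sampler in row 2's `RevOp` format on the class of bounded measurable observables — hence the VARIATIONAL FLOOR and the PESKUN–TIERNEY COMPARISON hold for reversible KERNELS on any state space

HONEST FRAMING: exact (Metropolis-corrected) sampling algorithms for lattice gauge theory;
figures of merit are autocorrelation/cost numbers at stated couplings and volumes; no
continuum-physics claim.

Venture `LatticeQCDFlow` (cell pub-lqcd), topic `Scoring`; FANOUT row 8 (`s0-cpn-nemc`, GEN-24).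
NEW WORK of the cell (a bridge, elementary): the admissible-class format `RevOp` of
`Exactness/ReversibleOperatorL2.lean` (weight `w ≥ 0`, class `A` with (int) (comb), operator with
(stab) (lin) (symm) (contr)) is instantiated at `μ = π`, `w = 1`,
`A = {f | Measurable f ∧ ∃ B, ∀ x, |f x| ≤ B}` and `K = kop κ` for a Mathlib Markov kernel `κ` with
`Kernel.Invariant κ π` (`Kernel.IsReversible κ π` for (symm)); the tree had this bridge only for row 2's
older bounded format (`Scoring/ReversibleKernelTauIntFloor.kop_opBdd/…`) and for the lattice-φ⁴ classes
(`BddObs`).  Consequently every `RevOp` theorem — the variational floor in Abel form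
(`ReversibleVariationalFloor`), its `τ_int` form (`ReversibleVariationalTauInt`), the comparison theorem
(`ReversibleComparison`) — becomes a statement about `autocov κ π g t = ∫ g (kop κ)^[t] g dπ` for the
cell's kernel-level samplers (heat-bath / Metropolis sweeps, HMC, the exact flow sampler, NCMC chains).
Nothing is cited as a fact; printed counterparts NAMED ONLY: Kipnis–Varadhan 1986,
Caracciolo–Pelissetto–Sokal 1990 (variational formula / trial-function floors), Peskun 1973, Tierney 1998.

## Content (`π` a probability law; observables bounded measurable; `C_g(t) = autocov κ π g t`)

* the class: `bddMeas_integrable_mul` (int), `bddMeas_add_mul` (comb), `kop_bddMeas` (stab),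
  `kop_lin_bddMeas` (lin), `kop_symm_bddMeas` (symm, `κ` reversible), `kop_contr_bddMeas` (contr, `π`
  invariant) — exactly the hypothesis shapes of the `RevOp` theorems with `w = 1`;
* **`sq_integral_mul_le_abelSum_mul_quadForm_of_isReversible`** — `κ` `π`-reversible, `g, v` bounded
  measurable, `0 ≤ r < 1`: `(∫ g v dπ)² ≤ (Σ_k C_g(k) rᵏ) · (∫ v² dπ − r ∫ v (kop κ v) dπ)`;
* **`tauInt_ge_variational_of_isReversible`** — under summability of `ρ_g` and `𝓔(v) > 0`:
  `τ_int(g) ≥ (∫ g v dπ)²/(C_g(0) 𝓔(v)) − ½`, `𝓔(v) = ∫ v² dπ − ∫ v (kop κ v) dπ`;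
* **`abelSum_le_of_dirichlet_le_of_isReversible`**, **`tauInt_le_of_dirichlet_le_of_isReversible`** —
  PESKUN–TIERNEY FOR KERNELS: two `π`-reversible Markov kernels with `𝓔₁(v) ≤ 𝓔₂(v)` for all bounded
  measurable `v` ⇒ `Σ_k C⁽²⁾_g(k) rᵏ ≤ Σ_k C⁽¹⁾_g(k) rᵏ` (unconditional) and, under summability,
  `τ⁽²⁾_int(g) ≤ τ⁽¹⁾_int(g)` for every bounded measurable `g` with `∫ g² dπ > 0`.

NOT CLAIMED: unbounded observables (the abstract class allows them; this instance does not); any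
number of ours.
-/

noncomputable section

namespace Summit.Ventures.LatticeQCDFlow.Scoring

open MeasureTheory ProbabilityTheory Filter Finset Summit.Ventures.LatticeQCDFlow.Exactness
open scoped ENNReal

variable {Ω : Type*} [MeasurableSpace Ω]

/-! ### §1 The class of bounded measurable observables -/

section Class

variable {π : Measure Ω} [IsFiniteMeasure π]

/-- (int) Products of bounded measurable observables (times the weight `1`) are `π`-integrable. -/
theorem bddMeas_integrable_mul :
    ∀ ⦃f h : Ω → ℝ⦄, (Measurable f ∧ ∃ B, ∀ x, |f x| ≤ B) → (Measurable h ∧ ∃ B, ∀ x, |h x| ≤ B) →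
      Integrable (fun x => f x * h x * (fun _ : Ω => (1 : ℝ)) x) π := by
  rintro f h ⟨hf, Bf, hBf⟩ ⟨hh, Bh, hBh⟩
  simp only [mul_one]
  refine integrable_of_bounded π (hf.mul hh) (C := |Bf| * Bh) fun x => ?_
  rw [abs_mul]
  exact mul_le_mul ((hBf x).trans (le_abs_self _)) (hBh x) (abs_nonneg _) (abs_nonneg _)

omit [IsFiniteMeasure π] in
/-- (comb) The class is closed under `f + c·h`. -/
theorem bddMeas_add_mul :
    ∀ ⦃f h : Ω → ℝ⦄ (c : ℝ), (Measurable f ∧ ∃ B, ∀ x, |f x| ≤ B) → (Measurable h ∧ ∃ B, ∀ x, |h x| ≤ B) →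
      (Measurable (fun x => f x + c * h x) ∧ ∃ B, ∀ x, |f x + c * h x| ≤ B) := by
  rintro f h c ⟨hf, Bf, hBf⟩ ⟨hh, Bh, hBh⟩
  refine ⟨hf.add (measurable_const.mul hh), Bf + |c| * Bh, fun x => ?_⟩
  calc |f x + c * h x| ≤ |f x| + |c * h x| := abs_add_le _ _
    _ ≤ Bf + |c| * Bh := by
        rw [abs_mul]; exact add_le_add (hBf x) (mul_le_mul_of_nonneg_left (hBh x) (abs_nonneg c))

end Class

section Operator

variable (κ : Kernel Ω Ω) [IsMarkovKernel κ] {π : Measure Ω}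

/-- (stab) `kop κ` maps the class to itself. -/
theorem kop_bddMeas : ∀ ⦃f : Ω → ℝ⦄, (Measurable f ∧ ∃ B, ∀ x, |f x| ≤ B) →
    (Measurable (kop κ f) ∧ ∃ B, ∀ x, |kop κ f x| ≤ B) := by
  rintro f ⟨hf, B, hB⟩
  exact ⟨measurable_kop κ hf, B, abs_kop_le κ hB⟩

/-- (lin) `kop κ` is linear on the class. -/
theorem kop_lin_bddMeas : ∀ ⦃f h : Ω → ℝ⦄ (c : ℝ), (Measurable f ∧ ∃ B, ∀ x, |f x| ≤ B) →
    (Measurable h ∧ ∃ B, ∀ x, |h x| ≤ B) →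
    ∀ x, kop κ (fun s => f s + c * h s) x = kop κ f x + c * kop κ h x := by
  rintro f h c ⟨hf, Bf, hBf⟩ ⟨hh, Bh, hBh⟩ x
  exact kop_add_mul κ hf hh hBf hBh c x

/-- (symm) a `π`-reversible kernel is symmetric on the class (weight `1`). -/
theorem kop_symm_bddMeas [IsFiniteMeasure π] (hrev : Kernel.IsReversible κ π) :
    ∀ ⦃f h : Ω → ℝ⦄, (Measurable f ∧ ∃ B, ∀ x, |f x| ≤ B) → (Measurable h ∧ ∃ B, ∀ x, |h x| ≤ B) →
      ∫ x, kop κ f x * h x * (fun _ : Ω => (1 : ℝ)) x ∂π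
        = ∫ x, f x * kop κ h x * (fun _ : Ω => (1 : ℝ)) x ∂π := by
  rintro f h ⟨hf, Bf, hBf⟩ ⟨hh, Bh, hBh⟩
  simp only [mul_one]
  exact integral_kop_mul_comm_of_isReversible κ hrev hf hh hBf hBh

/-- (contr) an invariant kernel is an `L²(π)`-contraction on the class (weight `1`). -/
theorem kop_contr_bddMeas [IsProbabilityMeasure π] (hinv : Kernel.Invariant κ π) :
    ∀ ⦃f : Ω → ℝ⦄, (Measurable f ∧ ∃ B, ∀ x, |f x| ≤ B) →
      ∫ x, kop κ f x ^ 2 * (fun _ : Ω => (1 : ℝ)) x ∂π ≤ ∫ x, f x ^ 2 * (fun _ : Ω => (1 : ℝ)) x ∂π := by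
  rintro f ⟨hf, B, hB⟩
  exact kop_opContr hinv hf hB

omit [IsMarkovKernel κ] in
/-- The weight-`1` Abel sum is the Abel sum of `autocov`. -/
theorem tsum_integral_mul_iterate_kop_mul_one (g : Ω → ℝ) (r : ℝ) :
    ∑' k, (∫ x, g x * (kop κ)^[k] g x * (fun _ : Ω => (1 : ℝ)) x ∂π) * r ^ k
      = ∑' k, autocov κ π g k * r ^ k :=
  tsum_congr fun k => by rw [integral_mul_iterate_kop_mul_one]

end Operator

/-! ### §2 The variational floor for reversible kernels -/

section Floor

variable {κ : Kernel Ω Ω} [IsMarkovKernel κ] {π : Measure Ω} [IsProbabilityMeasure π]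

/-- **THE VARIATIONAL FLOOR FOR A REVERSIBLE KERNEL (Abel form, unconditional).**  `κ` `π`-reversible,
`g, v` bounded measurable, `0 ≤ r < 1`:
`(∫ g v dπ)² ≤ (Σ_k autocov κ π g k · rᵏ) · (∫ v² dπ − r ∫ v (kop κ v) dπ)`. -/
theorem sq_integral_mul_le_abelSum_mul_quadForm_of_isReversible (hrev : Kernel.IsReversible κ π)
    {g v : Ω → ℝ} (hg : Measurable g) (hv : Measurable v) {Bg Bv : ℝ} (hBg : ∀ x, |g x| ≤ Bg)
    (hBv : ∀ x, |v x| ≤ Bv) {r : ℝ} (hr0 : 0 ≤ r) (hr1 : r < 1) :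
    (∫ x, g x * v x ∂π) ^ 2
      ≤ (∑' k, autocov κ π g k * r ^ k) * ((∫ x, v x ^ 2 ∂π) - r * ∫ x, v x * kop κ v x ∂π) := by
  have h := RevOp.sq_inner_le_abelSum_mul_quadForm (μ := π) (w := fun _ : Ω => (1 : ℝ))
    (A := fun f : Ω → ℝ => Measurable f ∧ ∃ B, ∀ x, |f x| ≤ B) (K := kop κ) (fun _ => zero_le_one)
    bddMeas_integrable_mul bddMeas_add_mul (kop_bddMeas κ) (kop_lin_bddMeas κ)
    (kop_symm_bddMeas κ hrev) (kop_contr_bddMeas κ hrev.invariant) ⟨hg, Bg, hBg⟩ ⟨hv, Bv, hBv⟩ hr0 hr1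
  rw [tsum_integral_mul_iterate_kop_mul_one] at h
  simpa only [mul_one] using h

/-- **THE VARIATIONAL `τ_int` FLOOR FOR A REVERSIBLE KERNEL.**  `κ` `π`-reversible, `g, v` bounded
measurable, the normalised autocorrelation series of `g` summable and `𝓔(v) = ∫ v² dπ − ∫ v (kop κ v) dπ > 0`:
`τ_int(g) ≥ (∫ g v dπ)² / (C_g(0) 𝓔(v)) − ½` (`Scoring.tauInt`, `C_g(t) = autocov κ π g t`). -/
theorem tauInt_ge_variational_of_isReversible (hrev : Kernel.IsReversible κ π)
    {g v : Ω → ℝ} (hg : Measurable g) (hv : Measurable v) {Bg Bv : ℝ} (hBg : ∀ x, |g x| ≤ Bg)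
    (hBv : ∀ x, |v x| ≤ Bv)
    (hs : Summable fun n => autocov κ π g (n + 1) / autocov κ π g 0)
    (hE : 0 < (∫ x, v x ^ 2 ∂π) - ∫ x, v x * kop κ v x ∂π) :
    (∫ x, g x * v x ∂π) ^ 2 / (autocov κ π g 0 * ((∫ x, v x ^ 2 ∂π) - ∫ x, v x * kop κ v x ∂π)) - 1 / 2
      ≤ tauInt (fun n => autocov κ π g n / autocov κ π g 0) := by
  have hC0 : autocov κ π g 0 = ∫ x, g x ^ 2 ∂π := autocov_zero κ π g
  have hs' : Summable fun n => (∫ x, g x * (kop κ)^[n + 1] g x * (fun _ : Ω => (1 : ℝ)) x ∂π)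
      / ∫ x, g x ^ 2 * (fun _ : Ω => (1 : ℝ)) x ∂π := by
    refine hs.congr fun n => ?_
    rw [integral_mul_iterate_kop_mul_one, hC0]; simp only [mul_one]
  have hE' : 0 < (∫ x, v x ^ 2 * (fun _ : Ω => (1 : ℝ)) x ∂π)
      - ∫ x, v x * kop κ v x * (fun _ : Ω => (1 : ℝ)) x ∂π := by simpa only [mul_one] using hE
  have h := RevOp.tauInt_ge_variational (μ := π) (w := fun _ : Ω => (1 : ℝ))
    (A := fun f : Ω → ℝ => Measurable f ∧ ∃ B, ∀ x, |f x| ≤ B) (K := kop κ) (fun _ => zero_le_one)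
    bddMeas_integrable_mul bddMeas_add_mul (kop_bddMeas κ) (kop_lin_bddMeas κ)
    (kop_symm_bddMeas κ hrev) (kop_contr_bddMeas κ hrev.invariant) ⟨hg, Bg, hBg⟩ ⟨hv, Bv, hBv⟩ hs' hE'
  have e : (fun n => (∫ x, g x * (kop κ)^[n] g x * (fun _ : Ω => (1 : ℝ)) x ∂π)
      / ∫ x, g x ^ 2 * (fun _ : Ω => (1 : ℝ)) x ∂π) = fun n => autocov κ π g n / autocov κ π g 0 := by
    funext n; rw [integral_mul_iterate_kop_mul_one, hC0]; simp only [mul_one]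
  rw [e] at h
  simpa only [mul_one, hC0] using h

end Floor

/-! ### §3 Peskun–Tierney for reversible kernels on a general state space -/

section Comparison

variable {κ₁ κ₂ : Kernel Ω Ω} [IsMarkovKernel κ₁] [IsMarkovKernel κ₂] {π : Measure Ω}
  [IsProbabilityMeasure π]

/-- **PESKUN–TIERNEY FOR KERNELS, ABEL FORM (unconditional).**  `κ₁, κ₂` `π`-reversible Markov kernels
with `𝓔₁(v) ≤ 𝓔₂(v)`, i.e. `∫ v (kop κ₂ v) dπ ≤ ∫ v (kop κ₁ v) dπ`, for every bounded measurable `v`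
("`κ₂` moves more").  Then for every bounded measurable `g` and `0 ≤ r < 1`:
`Σ_k autocov κ₂ π g k · rᵏ ≤ Σ_k autocov κ₁ π g k · rᵏ`. -/
theorem abelSum_le_of_dirichlet_le_of_isReversible (h₁ : Kernel.IsReversible κ₁ π)
    (h₂ : Kernel.IsReversible κ₂ π)
    (hdom : ∀ ⦃v : Ω → ℝ⦄, Measurable v → ∀ ⦃B : ℝ⦄, (∀ x, |v x| ≤ B) →
      ∫ x, v x * kop κ₂ v x ∂π ≤ ∫ x, v x * kop κ₁ v x ∂π)
    {g : Ω → ℝ} (hg : Measurable g) {Bg : ℝ} (hBg : ∀ x, |g x| ≤ Bg) {r : ℝ} (hr0 : 0 ≤ r)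
    (hr1 : r < 1) :
    ∑' k, autocov κ₂ π g k * r ^ k ≤ ∑' k, autocov κ₁ π g k * r ^ k := by
  have h := RevOp.abelSum_le_of_dirichlet_le (μ := π) (w := fun _ : Ω => (1 : ℝ))
    (A := fun f : Ω → ℝ => Measurable f ∧ ∃ B, ∀ x, |f x| ≤ B) (K := kop κ₁) (K' := kop κ₂)
    (fun _ => zero_le_one) bddMeas_integrable_mul bddMeas_add_mul (kop_bddMeas κ₁) (kop_lin_bddMeas κ₁)
    (kop_symm_bddMeas κ₁ h₁) (kop_contr_bddMeas κ₁ h₁.invariant) (kop_bddMeas κ₂) (kop_lin_bddMeas κ₂)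
    (kop_symm_bddMeas κ₂ h₂) (kop_contr_bddMeas κ₂ h₂.invariant)
    (by
      rintro v ⟨hv, B, hB⟩
      simp only [mul_one]
      linarith [hdom hv hB])
    ⟨hg, Bg, hBg⟩ hr0 hr1
  rwa [tsum_integral_mul_iterate_kop_mul_one, tsum_integral_mul_iterate_kop_mul_one] at h

/-- **PESKUN–TIERNEY FOR KERNELS, `τ_int` FORM.**  As above, with `∫ g² dπ > 0` and both normalised
autocorrelation series summable: `τ_int(g; κ₂) ≤ τ_int(g; κ₁)` (`Scoring.tauInt`). -/
theorem tauInt_le_of_dirichlet_le_of_isReversible (h₁ : Kernel.IsReversible κ₁ π)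
    (h₂ : Kernel.IsReversible κ₂ π)
    (hdom : ∀ ⦃v : Ω → ℝ⦄, Measurable v → ∀ ⦃B : ℝ⦄, (∀ x, |v x| ≤ B) →
      ∫ x, v x * kop κ₂ v x ∂π ≤ ∫ x, v x * kop κ₁ v x ∂π)
    {g : Ω → ℝ} (hg : Measurable g) {Bg : ℝ} (hBg : ∀ x, |g x| ≤ Bg) (hP : 0 < ∫ x, g x ^ 2 ∂π)
    (hs₁ : Summable fun n => autocov κ₁ π g (n + 1) / autocov κ₁ π g 0)
    (hs₂ : Summable fun n => autocov κ₂ π g (n + 1) / autocov κ₂ π g 0) :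
    tauInt (fun n => autocov κ₂ π g n / autocov κ₂ π g 0)
      ≤ tauInt (fun n => autocov κ₁ π g n / autocov κ₁ π g 0) := by
  have hC1 : autocov κ₁ π g 0 = ∫ x, g x ^ 2 ∂π := autocov_zero κ₁ π g
  have hC2 : autocov κ₂ π g 0 = ∫ x, g x ^ 2 ∂π := autocov_zero κ₂ π g
  have conv : ∀ (η : Kernel Ω Ω) (n : ℕ),
      (∫ x, g x * (kop η)^[n] g x * (fun _ : Ω => (1 : ℝ)) x ∂π) / ∫ x, g x ^ 2 * (fun _ : Ω => (1 : ℝ)) x ∂π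
        = autocov η π g n / ∫ x, g x ^ 2 ∂π := fun η n => by
    rw [integral_mul_iterate_kop_mul_one]; simp only [mul_one]
  have hP' : 0 < ∫ x, g x ^ 2 * (fun _ : Ω => (1 : ℝ)) x ∂π := by simpa only [mul_one] using hP
  have hs₁' : Summable fun n => (∫ x, g x * (kop κ₁)^[n + 1] g x * (fun _ : Ω => (1 : ℝ)) x ∂π)
      / ∫ x, g x ^ 2 * (fun _ : Ω => (1 : ℝ)) x ∂π :=
    (hs₁.congr fun n => by rw [hC1]).congr fun n => (conv κ₁ (n + 1)).symm
  have hs₂' : Summable fun n => (∫ x, g x * (kop κ₂)^[n + 1] g x * (fun _ : Ω => (1 : ℝ)) x ∂π)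
      / ∫ x, g x ^ 2 * (fun _ : Ω => (1 : ℝ)) x ∂π :=
    (hs₂.congr fun n => by rw [hC2]).congr fun n => (conv κ₂ (n + 1)).symm
  have h := RevOp.tauInt_le_of_dirichlet_le (μ := π) (w := fun _ : Ω => (1 : ℝ))
    (A := fun f : Ω → ℝ => Measurable f ∧ ∃ B, ∀ x, |f x| ≤ B) (K := kop κ₁) (K' := kop κ₂)
    (fun _ => zero_le_one) bddMeas_integrable_mul bddMeas_add_mul (kop_bddMeas κ₁) (kop_lin_bddMeas κ₁)
    (kop_symm_bddMeas κ₁ h₁) (kop_contr_bddMeas κ₁ h₁.invariant) (kop_bddMeas κ₂) (kop_lin_bddMeas κ₂)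
    (kop_symm_bddMeas κ₂ h₂)
    (by
      rintro v ⟨hv, B, hB⟩
      simp only [mul_one]
      linarith [hdom hv hB])
    ⟨hg, Bg, hBg⟩ hP' hs₁' hs₂'
  have e1 : (fun n => (∫ x, g x * (kop κ₁)^[n] g x * (fun _ : Ω => (1 : ℝ)) x ∂π)
      / ∫ x, g x ^ 2 * (fun _ : Ω => (1 : ℝ)) x ∂π) = fun n => autocov κ₁ π g n / autocov κ₁ π g 0 := by
    funext n; rw [conv, hC1]
  have e2 : (fun n => (∫ x, g x * (kop κ₂)^[n] g x * (fun _ : Ω => (1 : ℝ)) x ∂π)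
      / ∫ x, g x ^ 2 * (fun _ : Ω => (1 : ℝ)) x ∂π) = fun n => autocov κ₂ π g n / autocov κ₂ π g 0 := by
    funext n; rw [conv, hC2]
  rwa [e1, e2] at h

end Comparison

end Summit.Ventures.LatticeQCDFlow.Scoring
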